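import Summits.AtomisticToContinuum.HydrodynamicLimit.Theorems.TwoClocksEquilibriumShearWindowLDGauss
import Summits.AtomisticToContinuum.HydrodynamicLimit.Theorems.TwoClocksEquilibriumShearWindowLDWindows
import Literature.Analysis.FluidPDE.HardSphereAlexander

/-!
# `EquilibriumShearWindowLD`: the one-particle (ideal-gas) calibration and the necessity of `N₀`
# (route TwoClocks, stmt-AtomisticToContinuum-14446; tightness of the quantifier `∃ N₀ ∀ N ≥ N₀`)

Helper file (`--supports` stmt-AtomisticToContinuum-14446). The item bounds the window exponential
moment of the kinetic shear stress `Σᵢ w⁻¹∫₀ʷ φ(xᵢ(r)) vᵢ⁰(r) vᵢ¹(r) dr` under the global Gibbs law by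
`exp(ε(N+1))` for all LARGE `N` (`∃ N₀ ∀ N ≥ N₀`). Here the smallest system is computed exactly:

* `collisionTimes_oneParticle`, `flow_oneParticle_eq_freeFlight`, `windowAverage_oneParticle` — one
  hard sphere on `𝕋³` never collides, its flow is free flight on the good set, and the window average
  of any velocity observable is its initial value (the ideal-gas kernel: time averaging does nothing
  without collisions);
* `shearStaticMoment_oneParticle_eq` — under the one-particle Gibbs law (uniform position, Maxwellian
  `N(0, θ₀·id)` velocity) `∫ exp(β v⁰v¹) dG₀ = (1 - β²θ₀²)^{-1/2}` exactly (disintegration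
  `lintegral_localGibbsMeasure` + `lintegral_exp_mul_shear_gaussMeasure`);
* `shearWindowMoment_oneParticle_eq` — hence at `N = 0`, `φ ≡ 1`, the item's window moment EQUALS
  `(1 - β²θ₀²)^{-1/2}` for every window `τ` and every flow: it does not decay in `τ`;
* `equilibriumShearWindowLD_forall_N_false` — consequently the mutation of
  `TwoClocks.EquilibriumShearWindowLD` with `∃ N₀, ∀ N ≥ N₀` replaced by `∀ N` is FALSE (witness
  `a₀ = θ₀ = 1`, `φ ≡ 1`, the tree's Alexander flows, `β = min β₀ ½`, `ε = β²/8`, `N = 0`: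
  `exp(β²/8) < (1 - β²)^{-1/2}`). The threshold `N₀` of the item is load-bearing.

References: H. Spohn, *Large Scale Dynamics of Interacting Particles* (1991), Part I §2.3; the
item docstring of `TwoClocks.EquilibriumFastWindowLD` ("crux 2 is false for free flight").

prover-pitem-stmt-AtomisticToContinuum-14446-c1-0.
-/

noncomputable section

open MeasureTheory Real Set
open scoped ENNReal

namespace Summit.AtomisticToContinuum.HydrodynamicLimit.Theorems

open Literature.Analysis.FluidPDE Literature.MathematicalPhysics.KineticTheory

/-! ### One particle: no collisions, free flight, trivial window averages -/

/-- A single hard sphere has no collision times (there is no pair `i ≠ j` in `Fin 1`). [folklore] -/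
theorem collisionTimes_oneParticle {d : Type*} [Fintype d] {X : Type*} (G : Geometry d X) (ε : ℝ)
    (γ : ℝ → Config 1 d X) : collisionTimes G ε γ = ∅ := by
  rw [Set.eq_empty_iff_forall_notMem]
  intro t ht
  obtain ⟨i, j, hij, -⟩ := mem_collisionTimes.1 ht
  exact hij (Subsingleton.elim i j)

/-- The flow of a single hard sphere is free flight on the good set (forward in time). [folklore] -/
theorem flow_oneParticle_eq_freeFlight {d : Type*} [Fintype d] {X : Type*} [MeasureSpace X]
    [TopologicalSpace X] {G : Geometry d X} {ε : ℝ} (Φ : HardSphereFlow G ε 1)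
    {z : Config 1 d X} (hz : z ∈ Φ.good) {t : ℝ} (ht : 0 ≤ t) :
    Φ.flow t z = freeFlight G t z := by
  have h := (Φ.isTrajectory z hz).free 0 t ht (fun τ _ => by
    rw [collisionTimes_oneParticle]; exact Set.notMem_empty τ)
  rwa [sub_zero, Φ.flow_zero z hz] at h

/-- The velocity of a single hard sphere is constant along its (good) orbit. [folklore] -/
theorem flow_oneParticle_vel {d : Type*} [Fintype d] {X : Type*} [MeasureSpace X]
    [TopologicalSpace X] {G : Geometry d X} {ε : ℝ} (Φ : HardSphereFlow G ε 1)
    {z : Config 1 d X} (hz : z ∈ Φ.good) {t : ℝ} (ht : 0 ≤ t) (i : Fin 1) :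
    (Φ.flow t z i).2 = (z i).2 := by
  rw [flow_oneParticle_eq_freeFlight Φ hz ht, freeFlight_apply]

/-- **Window averages of a single hard sphere are trivial**: for `z` good, `w > 0` and any velocity
observable `f`, `w⁻¹ ∫₀ʷ f(v(r)) dr = f(v(0))` (no collisions: the ideal-gas kernel of every
kinetic-window statement). [folklore] -/
theorem windowAverage_oneParticle {d : Type*} [Fintype d] {X : Type*} [MeasureSpace X]
    [TopologicalSpace X] {G : Geometry d X} {ε : ℝ} (Φ : HardSphereFlow G ε 1)
    {z : Config 1 d X} (hz : z ∈ Φ.good) (f : EuclideanSpace ℝ d → ℝ) (i : Fin 1) {w : ℝ}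
    (hw : 0 < w) :
    w⁻¹ * ∫ r in (0 : ℝ)..w, f (Φ.flow r z i).2 = f (z i).2 := by
  have h : ∫ r in (0 : ℝ)..w, f (Φ.flow r z i).2 = ∫ _ in (0 : ℝ)..w, f (z i).2 := by
    refine intervalIntegral.integral_congr fun r hr => ?_
    rw [Set.uIcc_of_le hw.le] at hr
    show f (Φ.flow r z i).2 = f (z i).2
    rw [flow_oneParticle_vel Φ hz hr.1 i]
  rw [h, intervalIntegral.integral_const, sub_zero, smul_eq_mul, ← mul_assoc,
    inv_mul_cancel₀ hw.ne', one_mul]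

/-! ### The one-particle Gibbs law: exact exponential moment of the shear stress -/

/-- **Exact static exponential moment of the kinetic shear stress for ONE particle** under the
global Gibbs law at rest (`localGibbsLaw σ a₀ 0 θ₀ 0 Φ`: uniform position on `𝕋³`, Maxwellian
`N(0, θ₀·id)` velocity): for `β²θ₀² < 1`, `∫ exp(β v⁰v¹) dG₀ = (1 - β²θ₀²)^{-1/2}`. [folklore] -/
theorem shearStaticMoment_oneParticle_eq {a₀ θ₀ : ℝ} (ha : 0 < a₀) (hθ : 0 < θ₀) {σ : ℝ}
    (hσ2 : σ ≤ 1 / 2) (Φ : HardSphereFlow (Torus.geometry (Fin 3)) (hsDiameter σ 0) (0 + 1))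
    {β : ℝ} (hβ : β ^ 2 * θ₀ ^ 2 < 1) :
    ∫⁻ z, ENNReal.ofReal (Real.exp (β * ((z 0).2 0 * (z 0).2 1)))
        ∂(localGibbsLaw σ (fun _ => a₀) (fun _ => 0) (fun _ => θ₀) 0 Φ) =
      ENNReal.ofReal ((1 - β ^ 2 * θ₀ ^ 2) ^ (-(1 / 2 : ℝ))) := by
  haveI : IsProbabilityMeasure
      (localGibbsMeasure σ (fun _ => a₀) (fun _ => (0 : V3)) (fun _ => θ₀) 0) :=
    isProbabilityMeasure_localGibbsMeasure (a₀ := fun _ => a₀) (θ₀ := fun _ => θ₀)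
      (u₀ := fun _ => (0 : V3)) continuous_const continuous_const continuous_const
      (fun _ => ha) (fun _ => hθ) hσ2 0
  set g : Config (0 + 1) (Fin 3) T3 → ℝ≥0∞ :=
    fun z => ENNReal.ofReal (Real.exp (β * ((z 0).2 0 * (z 0).2 1))) with hg
  have hgm : Measurable g := by
    simp only [hg]
    fun_prop
  rw [localGibbsLaw_eq, lintegral_localGibbsMeasure (a₀ := fun _ => a₀) (θ₀ := fun _ => θ₀)
    (u₀ := fun _ => (0 : V3)) continuous_const continuous_const continuous_const
    (fun _ => ha.le) (fun _ => hθ) σ 0 hgm]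
  -- the velocity fibre integral does not depend on the position
  have hf : Measurable fun w : V3 => ENNReal.ofReal (Real.exp (β * (w 0 * w 1))) := by
    fun_prop
  have hinner : ∀ x : Fin (0 + 1) → T3,
      ∫⁻ v, g (zipConfig (x, v)) ∂velMeasure (fun _ => (0 : V3)) (fun _ => θ₀) x =
        ENNReal.ofReal ((1 - β ^ 2 * θ₀ ^ 2) ^ (-(1 / 2 : ℝ))) := by
    intro x
    have hev := measurePreserving_eval (fun _ : Fin (0 + 1) => gaussMeasure (0 : V3) θ₀) 0
    have h1 : ∫⁻ v, g (zipConfig (x, v)) ∂velMeasure (fun _ => (0 : V3)) (fun _ => θ₀) x =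
        ∫⁻ v : Fin (0 + 1) → V3, (fun w : V3 => ENNReal.ofReal (Real.exp (β * (w 0 * w 1)))) (v 0)
          ∂Measure.pi (fun _ : Fin (0 + 1) => gaussMeasure (0 : V3) θ₀) := rfl
    rw [h1, hev.lintegral_comp hf]
    exact lintegral_exp_mul_shear_gaussMeasure hθ hβ
  simp_rw [hinner]
  rw [lintegral_mul_const' _ _ ENNReal.ofReal_ne_top,
    lintegral_posWeight_eq_one (a₀ := fun _ => a₀) (θ₀ := fun _ => θ₀) (u₀ := fun _ => (0 : V3))
      continuous_const continuous_const continuous_const (fun _ => ha.le) (fun _ => hθ) σ 0,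
    one_mul]

/-- **The window exponential moment of the kinetic shear stress at `N = 0` is the static Gaussian
value, for every window and every flow** (ideal-gas calibration of the item): for `a₀, θ₀ > 0`,
`σ ≤ 1/2`, `β²θ₀² < 1` and any `w > 0`,
`∫ exp(β Σ_{i : Fin 1} w⁻¹∫₀ʷ v_i⁰(r) v_i¹(r) dr) dG₀ = (1 - β²θ₀²)^{-1/2}` — no decay in the window:
one sphere never collides. [folklore] -/
theorem shearWindowMoment_oneParticle_eq {a₀ θ₀ : ℝ} (ha : 0 < a₀) (hθ : 0 < θ₀) {σ : ℝ}
    (hσ2 : σ ≤ 1 / 2) (Φ : HardSphereFlow (Torus.geometry (Fin 3)) (hsDiameter σ 0) (0 + 1))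
    {β : ℝ} (hβ : β ^ 2 * θ₀ ^ 2 < 1) {w : ℝ} (hw : 0 < w) :
    ∫⁻ z, ENNReal.ofReal (Real.exp (β * ∑ i : Fin (0 + 1),
        w⁻¹ * ∫ r in (0 : ℝ)..w, ((Φ.flow r z i).2 0 * (Φ.flow r z i).2 1)))
        ∂(localGibbsLaw σ (fun _ => a₀) (fun _ => 0) (fun _ => θ₀) 0 Φ) =
      ENNReal.ofReal ((1 - β ^ 2 * θ₀ ^ 2) ^ (-(1 / 2 : ℝ))) := by
  rw [← shearStaticMoment_oneParticle_eq ha hθ hσ2 Φ hβ]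
  have hae : ∀ᵐ z ∂(localGibbsLaw σ (fun _ => a₀) (fun _ => 0) (fun _ => θ₀) 0 Φ), z ∈ Φ.good :=
    mem_ae_iff.2 (localGibbsLaw_const_compl_good σ a₀ θ₀ 0 0 Φ)
  refine lintegral_congr_ae ?_
  filter_upwards [hae] with z hz
  rw [Fin.sum_univ_one, windowAverage_oneParticle Φ hz (fun v => v 0 * v 1) 0 hw]

/-! ### The threshold `N₀` is necessary -/

/-- For `0 < x ≤ 1/4`: `exp(x/8) < (1 - x)^{-1/2}` (from `1 - x/4 ≤ exp(-x/4)` and `1 - x < 1 - x/4`).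
[folklore] -/
theorem exp_div_eight_lt_rpow_neg_half {x : ℝ} (hx : 0 < x) (hx4 : x ≤ 1 / 4) :
    Real.exp (x / 8) < (1 - x) ^ (-(1 / 2 : ℝ)) := by
  have h1x : 0 < 1 - x := by linarith
  have hsqrt : 0 < Real.sqrt (1 - x) := Real.sqrt_pos.2 h1x
  rw [Real.rpow_neg h1x.le, ← Real.sqrt_eq_rpow, lt_inv_comm₀ (Real.exp_pos _) hsqrt]
  -- `√(1-x) < exp(-x/8)` iff (squares) `1 - x < exp(-x/4)`
  have hkey : 1 - x < Real.exp (-(x / 8)) ^ 2 := by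
    rw [← Real.exp_nat_mul]
    have h := Real.one_sub_le_exp_neg (x / 4)
    have h' : (1 : ℝ) - x < 1 - x / 4 := by linarith
    calc (1 : ℝ) - x < 1 - x / 4 := h'
      _ ≤ Real.exp (-(x / 4)) := h
      _ = Real.exp ((2 : ℕ) * -(x / 8)) := by congr 1; push_cast; ring
  have hlt : Real.sqrt (1 - x) < Real.exp (-(x / 8)) := by
    rw [← Real.sqrt_sq (Real.exp_pos (-(x / 8))).le]
    exact Real.sqrt_lt_sqrt h1x.le hkey
  rwa [Real.exp_neg] at hlt

/-- **The `∀ N` mutation of `TwoClocks.EquilibriumShearWindowLD` is false: the threshold `N₀` is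
load-bearing.** Replacing `∃ N₀, ∀ N ≥ N₀` by `∀ N` in the item makes it fail at `N = 0` (one hard
sphere, free flight): with `a₀ = θ₀ = 1`, `φ ≡ 1`, the tree's Alexander flows
(`HardSphereFlow.nonempty_torus_holds`), `β = min β₀ ½` and `ε = β²/8`, the window moment equals
`(1 - β²)^{-1/2}` for every window (`shearWindowMoment_oneParticle_eq`) while the mutated bound asks
for `≤ exp(β²/8) < (1 - β²)^{-1/2}`. (The same momentum-mode arithmetic suggests `N₀ ≳ β²θ₀²/(2ε)`
in the item itself; only `N = 0` is certified here.) [folklore] -/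
theorem equilibriumShearWindowLD_forall_N_false :
    ¬ (∃ σ₀ : ℝ, 0 < σ₀ ∧ ∀ (a₀ θ₀ : ℝ), 0 < a₀ → 0 < θ₀ → ∀ σ : ℝ, 0 < σ → σ < σ₀ →
      ∀ Φ : (N : ℕ) → HardSphereFlow (Torus.geometry (Fin 3)) (hsDiameter σ N) (N + 1),
      ∀ φ : T3 → ℝ, Continuous φ → ∃ β₀ : ℝ, 0 < β₀ ∧ ∀ β : ℝ, |β| ≤ β₀ → ∀ ε : ℝ, 0 < ε →
      ∃ τ : ℝ, 0 < τ ∧ ∀ N : ℕ,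
        ∫⁻ z, ENNReal.ofReal (Real.exp (β * ∑ i : Fin (N + 1),
          (τ * ((N : ℝ) + 1) ^ (-(1 / 3 : ℝ)))⁻¹ *
            ∫ r in (0 : ℝ)..(τ * ((N : ℝ) + 1) ^ (-(1 / 3 : ℝ))),
              φ ((Φ N).flow r z i).1 * (((Φ N).flow r z i).2 0 * ((Φ N).flow r z i).2 1)))
          ∂(localGibbsLaw σ (fun _ => a₀) (fun _ => 0) (fun _ => θ₀) N (Φ N)) ≤
        ENNReal.ofReal (Real.exp (ε * ((N : ℝ) + 1)))) := by
  rintro ⟨σ₀, hσ₀, h⟩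
  -- a reduced density in range
  set σ : ℝ := min (σ₀ / 2) (1 / 4) with hσdef
  have hσpos : 0 < σ := lt_min (by linarith) (by norm_num)
  have hσlt : σ < σ₀ := (min_le_left _ _).trans_lt (by linarith)
  have hσ2 : σ ≤ 1 / 2 := (min_le_right _ _).trans (by norm_num)
  have hσhalf : σ < 2⁻¹ := (min_le_right _ _).trans_lt (by norm_num)
  -- the hard-sphere flows exist (Alexander's theorem, proved in the tree)
  have hΦ : ∀ N : ℕ, Nonempty (HardSphereFlow (Torus.geometry (Fin 3)) (hsDiameter σ N) (N + 1)) :=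
    fun N => HardSphereFlow.nonempty_torus_holds (hsDiameter_pos hσpos N)
      ((hsDiameter_le hσpos.le N).trans_lt hσhalf) (N + 1)
  set Φ : (N : ℕ) → HardSphereFlow (Torus.geometry (Fin 3)) (hsDiameter σ N) (N + 1) :=
    fun N => Classical.choice (hΦ N) with hΦdef
  obtain ⟨β₀, hβ₀, hβ⟩ := h 1 1 one_pos one_pos σ hσpos hσlt Φ (fun _ => 1) continuous_const
  -- a tilt in range
  set β : ℝ := min β₀ (1 / 2) with hβdef
  have hβpos : 0 < β := lt_min hβ₀ (by norm_num)
  have hβle : |β| ≤ β₀ := by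
    rw [abs_of_pos hβpos]
    exact min_le_left _ _
  have hβhalf : β ≤ 1 / 2 := min_le_right _ _
  have hβsq : β ^ 2 ≤ 1 / 4 := by nlinarith
  have hβ1 : β ^ 2 * (1 : ℝ) ^ 2 < 1 := by rw [one_pow, mul_one]; linarith
  obtain ⟨τ, hτ, hN⟩ := hβ β hβle (β ^ 2 / 8) (by positivity)
  have h0 := hN 0
  -- at `N = 0` the window is `τ` and the moment is the exact Gaussian value
  have hw : 0 < τ * (((0 : ℕ) : ℝ) + 1) ^ (-(1 / 3 : ℝ)) :=
    mul_pos hτ (Real.rpow_pos_of_pos (by positivity) _)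
  have hval := shearWindowMoment_oneParticle_eq one_pos one_pos hσ2 (Φ 0) hβ1 hw
  simp only [one_mul] at h0
  rw [hval, Nat.cast_zero, zero_add, mul_one, one_pow, mul_one,
    ENNReal.ofReal_le_ofReal_iff (Real.exp_pos _).le] at h0
  exact absurd h0 (not_le.2 (exp_div_eight_lt_rpow_neg_half (by positivity) hβsq))

end Summit.AtomisticToContinuum.HydrodynamicLimit.Theorems

end
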